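import Summits.QuantumFields.YangMills.Theorems.FluctuationComparisonRegPrIntLS2BetaCoarseCurlRowsLL
import HarnessLib

/-!
# S2β · (CURL-AVG ∕ rows v2, LETTER M-1‴) THE ROWS WITH A FREE SECOND-ORDER REMAINDER LETTER: the one-step coarse-curl bound and the (K5)-shape tower rows for
# `ρ_i(x) = ‖Y_{U_i}(∂q_x)[X̂_i]‖`, generic `SU(N)`, with the chart remainder entering ONLY through a per-plaquette letter `R` — `‖↑(ψ_{U₀}(X)c) − ↑((Dψ_{U₀}(0)X)c)‖ ≤ R` on the
# FOUR bonds of `∂p′` — so that any (β-3)′ edition (✓p834640 `…le_flat_osc`, FILE C₂ `…le_curved_osc`, ✓p833442 `…le_of_split`, or (β-3) ✓`…le_global`) is plugged per plaquette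

Cell `ym3-torus` (YM ladder rung R3 = continuum `SU(2)` Yang–Mills on the three-torus at fixed lattice data — a RUNG: NOT d = 4, NOT infinite volume, NOT a mass gap,
NOT Clay).  Width seat `ym3-torus-px13` (gen 28); crux `stmt-QuantumFields-20520`, LINE g18-1 S2β, pairing lane; (SCT″-c)₁ = (K5′)+(BKG)+(RSP-Σ)+(β-3)′ (desk §103.4); the c₁ budget core
(px10 g26, architect px17 g22 2026-08-31T21:24:01Z) takes «rows v2 ∕ (BKG)-linear ∕ OSC ∕ (RSP-Σ) as NAMED hypotheses until their bytes land».  ✓M-1′ `…S2BetaCoarseCurlRowsLL` (p831575)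
typed the rows with the ADDITIVE (β-3) source `4·4550400·ℓ²·M²` (`SU(2)`) — the channel FROZEN by HAZARD «SRC-q (2)» ∕ RULING (β-3)′.  THIS FILE re-types the same rows with the
second-order chart remainder as a FREE LETTER `R` (per level and coarse site), generic `N`, no radius bookkeeping: the row algebra (C ✓`norm_curl_fderiv_chartRead_le` first order,
E locality ∕ corner truncation, M-1′ LR→LL re-reading) is separated from the choice of the order-2 estimate, which the budget core makes per plaquette.
`--kind proof --supports stmt-QuantumFields-20520 --as helper`, count-neutral, DEFINITION-FREE (0 `def`, 0 `instance`, 0 `notation`, 0 `sorry`, default heartbeats).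

WHAT IS PROVED (sorry-free; `ℓ = (d+2)L`, `|I| = L^d(d!)²`; `Y_V(γ)[Z] = covWalkSum V Z γ`; `∂p′ = walk y′ [μ⁺,ν⁺,μ̄,ν̄]`, its four bonds `⟨y′,μ⟩, ⟨y′+e_μ,ν⟩, ⟨y′+e_ν,μ⟩, ⟨y′,ν⟩`).
§1 ★`norm_covWalkSum_plaq_le_of_four` — `‖Y_V(∂p′)[Z]‖ ≤ 4m` from `‖Z c‖ ≤ m` on the FOUR bonds only (✓`covWalkSum_walk_plaq_eq`, ✓`norm_coe_conj_le`).
§2 ★★★`norm_curl_chartRead_le_of_remainder` (generic `N`, global size `‖X‖`): C's first-order bound + `4R`.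
§3 ★★★`norm_curl_chartRead_le_local_of_remainder`: sizes `M ≥ ‖X b‖` on the four corner blocks; the letter `R` is asked for `X` itself on the four bonds (their read regions are corner
   blocks: (D1-loc) ✓`chartRead_apply_local`, ✓`fderiv_chartRead_apply_local` transfer it to the corner truncation).
§4 ★★★`row_LL_of_remainder`: the (K5) lower-left re-reading (✓M-1′ `summand_LR_le_LL`, `+ 2δL²M`).
§5 ★★★`rows_LL_tower_of_remainder`, ★★`rows_LL_tower_of_remainder_K5` — the tower edition and px16's (K5) binders VERBATIM with
   `src i x = L·L·2δ_i(3L+2)·M i x + 48α_i·L·M i x + (2α^p_i + 24α_i)·ℓ·M i x + 4·404·ℓ·α_i·M i x + 4·R i x + 2δ_i·L²·M i x`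
   under the letter `hR : ∀ i < r, ∀ y′, ∀ c ∈ four bonds of ∂(y′;μ,ν), ‖↑(ψ_{U i}(X i)c) − ↑((Dψ_{U i}(0)(X i))c)‖ ≤ R (i+1) y′`.
HOW THE LETTER IS DISCHARGED (not here): flat pieces — ✓p834640 `norm_chartRead_sub_fderiv_le_flat_osc`; a background `κ`-close to `1` on the corner blocks — FILE C₂
`norm_chartRead_sub_fderiv_le_curved_osc` (`R = 8B·OSC²∕(a−‖A‖)² + 32B·OSC·‖A‖∕a² + (ℓ‖A‖)³ + 8·(67ℓκ)·M²∕a²`); anywhere — (β-3) ✓`norm_chartRead_sub_fderiv_le_global` (recovers M-1′).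

HONEST.  Matrix bookkeeping, locality and re-indexing over landed files (C, E, M-1′, (D1-loc)); nothing of Bałaban's analysis is asserted or proved; the guards, sizes, `R`, the OSC-lift
letter, (RSP-Σ), (BKG), the c₁ budget core, (ST‴), (SCT″-c)₁₂₃, LOC‴, GAP♯∘ (`stub_uniformFibreGapOrbit`, registry 3732b7df UNTOUCHED, 0∕5), the five REGISTERED stubs, S2β, crux 20520,
19936, 19200, `YM3TorusSU2` — NOT proved (HYPOTHESES ∕ elsewhere); rung R3 = SU(2) YM₃ on T³ — NOT d = 4, NOT infinite volume, NOT a mass gap, NOT Clay; the Yang–Mills mass gap is NOT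
proved.  Axioms standard.

References: [Balaban1985Averaging] T. Bałaban, CMP **98** (1985) 17–51, (9) p.19, (19)–(20) p.21, Prop. 1 (51) p.26, (56)–(58) p.27, Prop. 3 (121)–(126) p.36, Prop. 4 (128)–(135)
pp.37–38; [Balaban1987RG1] CMP **109** (1987) 249–301, (0.1)–(0.4), (0.8), (0.18) pp.251–255.
-/

set_option autoImplicit false

noncomputable section

open scoped Matrix.Norms.L2Operator BigOperators
open Finset

namespace Summit.QuantumFields.YangMills.Theorems.FluctuationComparisonRegPrIntLS2BetaCoarseCurlRowsRem

open Literature.MathematicalPhysics.QuantumFieldTheory.Balaban1983to89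
open Literature.MathematicalPhysics.QuantumFieldTheory.Balaban1983to89.T4Continuum
open Literature.MathematicalPhysics.QuantumFieldTheory.Balaban1983to89.HaarExponentialChart
open Literature.MathematicalPhysics.QuantumFieldTheory.Balaban1983to89.HaarExponentialChart.IsChartRep
open Literature.MathematicalPhysics.QuantumFieldTheory.Balaban1983to89.BlockAveraging (Idx avgFun loopHol off corr Small)
open Literature.MathematicalPhysics.QuantumFieldTheory.Balaban1983to89.ExpMeanLog (expMeanLogSU deltaSU)
open Literature.MathematicalPhysics.QuantumFieldTheory.Balaban1983to89.BlockAveragingEMLLinearised (stepFactor length_walk walkEnd_emb_stairWord_eq_blockSite)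
open Literature.MathematicalPhysics.QuantumFieldTheory.Balaban1983to89.BlockAveragingEMLLinearisedBackground
  (covStep covWalkSum covWalkSum_nil covWalkSum_cons covWalkSum_add covLinAvgR0 norm_covWalkSum_le)
open Literature.MathematicalPhysics.QuantumFieldTheory.Balaban1983to89.B10StarCount (shift_unshift unshift_shift)
open Literature.MathematicalPhysics.QuantumFieldTheory.Balaban1983to89.B10Eq47AxialChi (shiftN shiftN_succ shiftN_zero)
open Literature.MathematicalPhysics.QuantumFieldTheory.Balaban1983to89.BlockAveragingEMLProp2 (shift_shift_comm shiftN_apply walkEnd_replicate_true)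
open Literature.MathematicalPhysics.QuantumFieldTheory.Balaban1983to89.Node00
open Summit.QuantumFields.YangMills.Theorems.FluctuationComparisonRegPrIntLS2BetaCovWalkSumStokes (norm_coe_conj_le norm_conj_sub_self_le)
open Summit.QuantumFields.YangMills.Theorems.FluctuationComparisonRegPrIntLS2BetaCoarseCurlTransports (covWalkSum_walk_plaq_eq shift_shift_unshift)
open Summit.QuantumFields.YangMills.Theorems.FluctuationComparisonRegPrIntLS2BetaChartReadDerivLocal (covWalkSum_congr chartRead_apply_local fderiv_chartRead_apply_local)
open Summit.QuantumFields.YangMills.Theorems.FluctuationComparisonRegPrIntLS2BetaCoarseCurlOfChartRead (covWalkSum_sub curlAvgBound_mono norm_curl_fderiv_chartRead_le)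
open Summit.QuantumFields.YangMills.Theorems.FluctuationComparisonRegPrIntLS2BetaCoarseCurlLocal (curl_chartRead_congr_of_corner norm_truncCorner_le blockOf_shiftN_shiftN_blockSite)
open Summit.QuantumFields.YangMills.Theorems.FluctuationComparisonRegPrIntLS2BetaCoarseCurlRowsLL (summand_LR_le_LL sum_Idx_range_range_eq_sum_product)

variable {P : Params} {j : ℕ} {N : ℕ} [NeZero N]

/-! ## §1 The four-term bound with a letter on the FOUR bonds of `∂p′` only -/

section Four

/-- **`‖Y_V(∂p′)[Z]‖ ≤ 4·m` WHEN `‖Z c‖ ≤ m` ON THE FOUR BONDS `⟨y,μ⟩, ⟨y+e_μ,ν⟩, ⟨y+e_ν,μ⟩, ⟨y,ν⟩` OF `∂p′`** (✓`covWalkSum_walk_plaq_eq`: the curl is the signed sum of the four bond values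
transported by unitaries, ✓`norm_coe_conj_le`). [cite: Balaban1985Averaging, (58) p.27 (bookkeeping)] -/
theorem norm_covWalkSum_plaq_le_of_four {k : ℕ} (V : GaugeField P k (SU N)) (Z : PBond P k → Matrix (Fin N) (Fin N) ℂ) (y : Site P k) (μ ν : Fin P.d) {m : ℝ}
    (hZ : ∀ c : PBond P k, (c = ⟨y, μ⟩ ∨ c = ⟨y.shift μ, ν⟩ ∨ c = ⟨y.shift ν, μ⟩ ∨ c = ⟨y, ν⟩) → ‖Z c‖ ≤ m) :
    ‖covWalkSum V Z (walk y [((μ, true) : Letter P.d), (ν, true), (μ, false), (ν, false)])‖ ≤ 4 * m := by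
  rw [covWalkSum_walk_plaq_eq]
  have h1 : ‖Z ⟨y, μ⟩‖ ≤ m := hZ _ (Or.inl rfl)
  have h2 : ‖((V ⟨y, μ⟩ : SU N) : Matrix (Fin N) (Fin N) ℂ) * Z ⟨y.shift μ, ν⟩ * star ((V ⟨y, μ⟩ : SU N) : Matrix (Fin N) (Fin N) ℂ)‖ ≤ m :=
    (norm_coe_conj_le _ _).trans (hZ _ (Or.inr (Or.inl rfl)))
  have h3 : ‖((V ⟨y, μ⟩ * V ⟨y.shift μ, ν⟩ * (V ⟨y.shift ν, μ⟩)⁻¹ : SU N) : Matrix (Fin N) (Fin N) ℂ) * Z ⟨y.shift ν, μ⟩ *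
      star ((V ⟨y, μ⟩ * V ⟨y.shift μ, ν⟩ * (V ⟨y.shift ν, μ⟩)⁻¹ : SU N) : Matrix (Fin N) (Fin N) ℂ)‖ ≤ m :=
    (norm_coe_conj_le _ _).trans (hZ _ (Or.inr (Or.inr (Or.inl rfl))))
  have h4 : ‖((V ⟨y, μ⟩ * V ⟨y.shift μ, ν⟩ * (V ⟨y.shift ν, μ⟩)⁻¹ * (V ⟨y, ν⟩)⁻¹ : SU N) : Matrix (Fin N) (Fin N) ℂ) * Z ⟨y, ν⟩ *
      star ((V ⟨y, μ⟩ * V ⟨y.shift μ, ν⟩ * (V ⟨y.shift ν, μ⟩)⁻¹ * (V ⟨y, ν⟩)⁻¹ : SU N) : Matrix (Fin N) (Fin N) ℂ)‖ ≤ m :=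
    (norm_coe_conj_le _ _).trans (hZ _ (Or.inr (Or.inr (Or.inr rfl))))
  have e := norm_sub_le_of_le (norm_sub_le_of_le (norm_add_le_of_le h1 h2) h3) h4
  linarith

end Four

/-! ## §2 ★★★ One step, generic `N`, global sizes: the coarse curl of `ψ_{U₀}(X)` with the remainder letter `R` -/

section OneStep

/-- ★★★ **(CURL-AVG) FOR `ψ_{U₀}(X)` WITH A FREE REMAINDER LETTER.**  At a background `U₀` in the loop `α`-guard at every coarse bond (`α ≤ 1∕24`, `α < δ_N`), `PlaqSmall δ U₀`, coarse
plaquette `p′ = (y; μ, ν)` with `dist1 Ū(U₀)(∂p′) ≤ α_p`, a direction `X`, and a letter `R` with `‖↑(ψ_{U₀}(X)c) − ↑((Dψ_{U₀}(0)X)c)‖ ≤ R` on the FOUR bonds of `∂p′`: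
`‖Y_{Ū(U₀)}(∂p′)[↑ψ_{U₀}(X)]‖ ≤ |I|⁻¹Σ_iΣ_{s,t<L}‖Y_{U₀}(∂q_{i,s,t})[X̂]‖ + L·L·2δ(3L+2)‖X‖ + 48αL‖X‖ + (2α_p + 24α)ℓ‖X‖ + 4·404ℓα‖X‖ + 4R` (C ✓`norm_curl_fderiv_chartRead_le` + §1).
[cite: Balaban1985Averaging, Prop. 1 (51) p.26, Prop. 3 (121)-(126) p.36; Balaban1987RG1, (0.4), (0.8) p.253] -/
theorem norm_curl_chartRead_le_of_remainder (U₀ : GaugeField P j (SU N)) {α : ℝ} (hα : ∀ (c : PBond P (j + 1)) (i : Idx P), dist1 (loopHol U₀ c i) ≤ α)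
    (hα24 : α ≤ 1 / 24) (hαδ : α < deltaSU (Fin N)) {δ : ℝ} (hδ : 0 ≤ δ) (hU : PlaqSmall δ U₀) (y : Site P (j + 1)) (μ ν : Fin P.d) {αp : ℝ}
    (hαp : dist1 (holAt (avgFun (expMeanLogSU (n := Fin N)) U₀) (walk y [((μ, true) : Letter P.d), (ν, true), (μ, false), (ν, false)])) ≤ αp)
    (X : PBond P j → (specialUnitaryLogChart (Fin N)).lie) {R : ℝ}
    (hrem : ∀ c : PBond P (j + 1), (c = ⟨y, μ⟩ ∨ c = ⟨y.shift μ, ν⟩ ∨ c = ⟨y.shift ν, μ⟩ ∨ c = ⟨y, ν⟩) →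
      ‖(((isChartRep_specialUnitaryGroup (n := Fin N)).logChart (avgFun (expMeanLogSU (n := Fin N)) (fun b => (isChartRep_specialUnitaryGroup (n := Fin N)).expChart (X b) * U₀ b) c * (avgFun (expMeanLogSU (n := Fin N)) U₀ c)⁻¹) : (specialUnitaryLogChart (Fin N)).lie) : Matrix (Fin N) (Fin N) ℂ) -
        ((fderiv ℝ (fun (A : PBond P j → (specialUnitaryLogChart (Fin N)).lie) (c : PBond P (j + 1)) => (isChartRep_specialUnitaryGroup (n := Fin N)).logChart (avgFun (expMeanLogSU (n := Fin N)) (fun b => (isChartRep_specialUnitaryGroup (n := Fin N)).expChart (A b) * U₀ b) c * (avgFun (expMeanLogSU (n := Fin N)) U₀ c)⁻¹)) 0 X c : (specialUnitaryLogChart (Fin N)).lie) : Matrix (Fin N) (Fin N) ℂ)‖ ≤ R) :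
    ‖covWalkSum (avgFun (expMeanLogSU (n := Fin N)) U₀)
        (fun c : PBond P (j + 1) => (((isChartRep_specialUnitaryGroup (n := Fin N)).logChart (avgFun (expMeanLogSU (n := Fin N)) (fun b => (isChartRep_specialUnitaryGroup (n := Fin N)).expChart (X b) * U₀ b) c * (avgFun (expMeanLogSU (n := Fin N)) U₀ c)⁻¹) : (specialUnitaryLogChart (Fin N)).lie) : Matrix (Fin N) (Fin N) ℂ))
        (walk y [((μ, true) : Letter P.d), (ν, true), (μ, false), (ν, false)])‖ ≤
      (Fintype.card (Idx P) : ℝ)⁻¹ * ∑ i : Idx P, ∑ s ∈ Finset.range P.L, ∑ t ∈ Finset.range P.L,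
          ‖covWalkSum U₀ (fun b => ((X b : (specialUnitaryLogChart (Fin N)).lie) : Matrix (Fin N) (Fin N) ℂ))
            (walk (walkEnd (walkEnd (emb y) (stairWord i.2.1 (off i.1))) (List.replicate (s + 1) (μ, true) ++ List.replicate t (ν, true)))
            [((ν, true) : Letter P.d), (μ, false), (ν, false), (μ, true)])‖ +
        (P.L : ℝ) * ((P.L : ℝ) * (2 * δ * ((P.L : ℝ) + 2 * P.L + 2) * ‖X‖)) + 48 * α * ((P.L : ℝ) * ‖X‖) +
        (2 * αp * ((((P.d + 2) * P.L : ℕ) : ℝ) * ‖X‖) + 24 * α * ((((P.d + 2) * P.L : ℕ) : ℝ) * ‖X‖)) +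
        4 * (404 * (((P.d + 2) * P.L : ℕ) : ℝ) * α * ‖X‖) + 4 * R := by
  set V := avgFun (expMeanLogSU (n := Fin N)) U₀ with hV
  set w : List (Letter P.d) := [((μ, true) : Letter P.d), (ν, true), (μ, false), (ν, false)] with hw
  set D : PBond P (j + 1) → Matrix (Fin N) (Fin N) ℂ := (fun c : PBond P (j + 1) => ((fderiv ℝ (fun (A : PBond P j → (specialUnitaryLogChart (Fin N)).lie) (c : PBond P (j + 1)) => (isChartRep_specialUnitaryGroup (n := Fin N)).logChart (avgFun (expMeanLogSU (n := Fin N)) (fun b => (isChartRep_specialUnitaryGroup (n := Fin N)).expChart (A b) * U₀ b) c * (avgFun (expMeanLogSU (n := Fin N)) U₀ c)⁻¹)) 0 X c : (specialUnitaryLogChart (Fin N)).lie) : Matrix (Fin N) (Fin N) ℂ)) with hD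
  set Ψ : PBond P (j + 1) → Matrix (Fin N) (Fin N) ℂ := (fun c : PBond P (j + 1) => (((isChartRep_specialUnitaryGroup (n := Fin N)).logChart (avgFun (expMeanLogSU (n := Fin N)) (fun b => (isChartRep_specialUnitaryGroup (n := Fin N)).expChart (X b) * U₀ b) c * (avgFun (expMeanLogSU (n := Fin N)) U₀ c)⁻¹) : (specialUnitaryLogChart (Fin N)).lie) : Matrix (Fin N) (Fin N) ℂ)) with hΨ
  have hD' := norm_curl_fderiv_chartRead_le U₀ hα hα24 hαδ hδ hU y μ ν hαp X
  have hrem' : ∀ c : PBond P (j + 1), (c = ⟨y, μ⟩ ∨ c = ⟨y.shift μ, ν⟩ ∨ c = ⟨y.shift ν, μ⟩ ∨ c = ⟨y, ν⟩) → ‖(Ψ - D) c‖ ≤ R := fun c hc => by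
    rw [Pi.sub_apply]; exact hrem c hc
  have hcurl_rem := norm_covWalkSum_plaq_le_of_four V (Ψ - D) y μ ν hrem'
  have e : covWalkSum V Ψ (walk y w) = covWalkSum V D (walk y w) + covWalkSum V (Ψ - D) (walk y w) := by
    rw [← covWalkSum_sub]; abel
  rw [e]
  exact (norm_add_le _ _).trans (add_le_add hD' hcurl_rem)

end OneStep

/-! ## §3 ★★★ The local edition: sizes on the four corner blocks -/

section Local

/-- ★★★ **THE LOCAL EDITION**: `‖X‖` replaced by any `M ≥ 0` bounding `‖X b‖` on the bonds issuing from the four corner blocks `y, y+e_μ, y+e_ν, y+e_μ+e_ν` (`μ ≠ ν`, standing range);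
the remainder letter is still asked on the four bonds of `∂p′` for `X` itself (their read regions `B(c₋) ∪ B(c₊)` are corner blocks, so the corner truncation `X′` has the same
`ψ(·)c`, `Dψ(0)(·)c` there: (D1-loc) ✓`chartRead_apply_local`, ✓`fderiv_chartRead_apply_local`; and the same coarse curl and dilution term, ✓E).
[cite: Balaban1985Averaging, p.19, Prop. 1 (51) p.26, Prop. 3 (121)-(126) p.36; Balaban1987RG1, (0.4), (0.8) p.253] -/
theorem norm_curl_chartRead_le_local_of_remainder (hj : j + 1 ≤ P.m + P.K) (U₀ : GaugeField P j (SU N)) {α : ℝ}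
    (hα : ∀ (c : PBond P (j + 1)) (i : Idx P), dist1 (loopHol U₀ c i) ≤ α) (hα24 : α ≤ 1 / 24) (hαδ : α < deltaSU (Fin N)) {δ : ℝ} (hδ : 0 ≤ δ)
    (hU : PlaqSmall δ U₀) (y : Site P (j + 1)) {μ ν : Fin P.d} (hμν : μ ≠ ν) {αp : ℝ}
    (hαp : dist1 (holAt (avgFun (expMeanLogSU (n := Fin N)) U₀) (walk y [((μ, true) : Letter P.d), (ν, true), (μ, false), (ν, false)])) ≤ αp)
    (X : PBond P j → (specialUnitaryLogChart (Fin N)).lie) {M : ℝ} (hM : 0 ≤ M)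
    (hXM : ∀ b : PBond P j, (blockOf b.src = y ∨ blockOf b.src = y.shift μ ∨ blockOf b.src = y.shift ν ∨ blockOf b.src = (y.shift μ).shift ν) → ‖X b‖ ≤ M) {R : ℝ}
    (hrem : ∀ c : PBond P (j + 1), (c = ⟨y, μ⟩ ∨ c = ⟨y.shift μ, ν⟩ ∨ c = ⟨y.shift ν, μ⟩ ∨ c = ⟨y, ν⟩) →
      ‖(((isChartRep_specialUnitaryGroup (n := Fin N)).logChart (avgFun (expMeanLogSU (n := Fin N)) (fun b => (isChartRep_specialUnitaryGroup (n := Fin N)).expChart (X b) * U₀ b) c * (avgFun (expMeanLogSU (n := Fin N)) U₀ c)⁻¹) : (specialUnitaryLogChart (Fin N)).lie) : Matrix (Fin N) (Fin N) ℂ) -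
        ((fderiv ℝ (fun (A : PBond P j → (specialUnitaryLogChart (Fin N)).lie) (c : PBond P (j + 1)) => (isChartRep_specialUnitaryGroup (n := Fin N)).logChart (avgFun (expMeanLogSU (n := Fin N)) (fun b => (isChartRep_specialUnitaryGroup (n := Fin N)).expChart (A b) * U₀ b) c * (avgFun (expMeanLogSU (n := Fin N)) U₀ c)⁻¹)) 0 X c : (specialUnitaryLogChart (Fin N)).lie) : Matrix (Fin N) (Fin N) ℂ)‖ ≤ R) :
    ‖covWalkSum (avgFun (expMeanLogSU (n := Fin N)) U₀)
        (fun c : PBond P (j + 1) => (((isChartRep_specialUnitaryGroup (n := Fin N)).logChart (avgFun (expMeanLogSU (n := Fin N)) (fun b => (isChartRep_specialUnitaryGroup (n := Fin N)).expChart (X b) * U₀ b) c * (avgFun (expMeanLogSU (n := Fin N)) U₀ c)⁻¹) : (specialUnitaryLogChart (Fin N)).lie) : Matrix (Fin N) (Fin N) ℂ))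
        (walk y [((μ, true) : Letter P.d), (ν, true), (μ, false), (ν, false)])‖ ≤
      (Fintype.card (Idx P) : ℝ)⁻¹ * ∑ i : Idx P, ∑ s ∈ Finset.range P.L, ∑ t ∈ Finset.range P.L,
          ‖covWalkSum U₀ (fun b => ((X b : (specialUnitaryLogChart (Fin N)).lie) : Matrix (Fin N) (Fin N) ℂ))
            (walk (walkEnd (walkEnd (emb y) (stairWord i.2.1 (off i.1))) (List.replicate (s + 1) (μ, true) ++ List.replicate t (ν, true)))
            [((ν, true) : Letter P.d), (μ, false), (ν, false), (μ, true)])‖ +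
        (P.L : ℝ) * ((P.L : ℝ) * (2 * δ * ((P.L : ℝ) + 2 * P.L + 2) * M)) + 48 * α * ((P.L : ℝ) * M) +
        (2 * αp * ((((P.d + 2) * P.L : ℕ) : ℝ) * M) + 24 * α * ((((P.d + 2) * P.L : ℕ) : ℝ) * M)) +
        4 * (404 * (((P.d + 2) * P.L : ℕ) : ℝ) * α * M) + 4 * R := by
  classical
  set X' : PBond P j → (specialUnitaryLogChart (Fin N)).lie := fun b => if (blockOf b.src = y ∨ blockOf b.src = y.shift μ ∨ blockOf b.src = y.shift ν ∨ blockOf b.src = (y.shift μ).shift ν) then X b else 0 with hX'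
  have hagree : ∀ b : PBond P j, (blockOf b.src = y ∨ blockOf b.src = y.shift μ ∨ blockOf b.src = y.shift ν ∨ blockOf b.src = (y.shift μ).shift ν) → X b = X' b := by
    intro b hb; simp only [hX', hb, if_true]
  have hagree' : ∀ b : PBond P j, (blockOf b.src = y ∨ blockOf b.src = y.shift μ ∨ blockOf b.src = y.shift ν ∨ blockOf b.src = (y.shift μ).shift ν) →
      (fun b => ((X' b : (specialUnitaryLogChart (Fin N)).lie) : Matrix (Fin N) (Fin N) ℂ)) b = (fun b => ((X b : (specialUnitaryLogChart (Fin N)).lie) : Matrix (Fin N) (Fin N) ℂ)) b := by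
    intro b hb; simp only [← hagree b hb]
  have hnorm : ‖X'‖ ≤ M := norm_truncCorner_le hM hXM
  have hα0 : 0 ≤ α := (GaugeGroup.dist1_nonneg _).trans (hα ⟨y, μ⟩ (Classical.arbitrary _))
  have hαp0 : 0 ≤ αp := (GaugeGroup.dist1_nonneg _).trans hαp
  have hsmall : ∀ c, Small (expMeanLogSU (n := Fin N)) U₀ c := fun c i => lt_of_le_of_lt (hα c i) hαδ
  -- the four bonds read `X` only on corner blocks
  have hfour : ∀ c : PBond P (j + 1), (c = ⟨y, μ⟩ ∨ c = ⟨y.shift μ, ν⟩ ∨ c = ⟨y.shift ν, μ⟩ ∨ c = ⟨y, ν⟩) →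
      ∀ b : PBond P j, (blockOf b.src = c.src ∨ blockOf b.src = c.tgt) → X b = X' b := by
    rintro c (rfl | rfl | rfl | rfl) b hb
    · exact hagree b (by rcases hb with hb | hb; exact Or.inl hb; exact Or.inr (Or.inl hb))
    · exact hagree b (by rcases hb with hb | hb; exact Or.inr (Or.inl hb); exact Or.inr (Or.inr (Or.inr hb)))
    · exact hagree b (by
        rcases hb with hb | hb
        · exact Or.inr (Or.inr (Or.inl hb))
        · refine Or.inr (Or.inr (Or.inr ?_)); rw [hb]; exact (shift_shift_comm y μ ν).symm)
    · exact hagree b (by rcases hb with hb | hb; exact Or.inl hb; exact Or.inr (Or.inr (Or.inl hb)))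
  have hrem' : ∀ c : PBond P (j + 1), (c = ⟨y, μ⟩ ∨ c = ⟨y.shift μ, ν⟩ ∨ c = ⟨y.shift ν, μ⟩ ∨ c = ⟨y, ν⟩) →
      ‖(((isChartRep_specialUnitaryGroup (n := Fin N)).logChart (avgFun (expMeanLogSU (n := Fin N)) (fun b => (isChartRep_specialUnitaryGroup (n := Fin N)).expChart (X' b) * U₀ b) c * (avgFun (expMeanLogSU (n := Fin N)) U₀ c)⁻¹) : (specialUnitaryLogChart (Fin N)).lie) : Matrix (Fin N) (Fin N) ℂ) -
        ((fderiv ℝ (fun (A : PBond P j → (specialUnitaryLogChart (Fin N)).lie) (c : PBond P (j + 1)) => (isChartRep_specialUnitaryGroup (n := Fin N)).logChart (avgFun (expMeanLogSU (n := Fin N)) (fun b => (isChartRep_specialUnitaryGroup (n := Fin N)).expChart (A b) * U₀ b) c * (avgFun (expMeanLogSU (n := Fin N)) U₀ c)⁻¹)) 0 X' c : (specialUnitaryLogChart (Fin N)).lie) : Matrix (Fin N) (Fin N) ℂ)‖ ≤ R := by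
    intro c hc
    rw [← chartRead_apply_local hj U₀ c (hfour c hc), ← fderiv_chartRead_apply_local hj U₀ hsmall c (hfour c hc)]
    exact hrem c hc
  have hC := norm_curl_chartRead_le_of_remainder U₀ hα hα24 hαδ hδ hU y μ ν hαp X' hrem'
  rw [← curl_chartRead_congr_of_corner hj U₀ (A := X) (A' := X') y μ ν hagree] at hC
  have hdil : ∀ i ∈ (Finset.univ : Finset (Idx P)), ∑ s ∈ Finset.range P.L, ∑ t ∈ Finset.range P.L,
      ‖covWalkSum U₀ (fun b => ((X' b : (specialUnitaryLogChart (Fin N)).lie) : Matrix (Fin N) (Fin N) ℂ))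
        (walk (walkEnd (walkEnd (emb y) (stairWord i.2.1 (off i.1))) (List.replicate (s + 1) (μ, true) ++ List.replicate t (ν, true)))
        [((ν, true) : Letter P.d), (μ, false), (ν, false), (μ, true)])‖ =
      ∑ s ∈ Finset.range P.L, ∑ t ∈ Finset.range P.L,
      ‖covWalkSum U₀ (fun b => ((X b : (specialUnitaryLogChart (Fin N)).lie) : Matrix (Fin N) (Fin N) ℂ))
        (walk (walkEnd (walkEnd (emb y) (stairWord i.2.1 (off i.1))) (List.replicate (s + 1) (μ, true) ++ List.replicate t (ν, true)))
        [((ν, true) : Letter P.d), (μ, false), (ν, false), (μ, true)])‖ := by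
    intro i _
    refine Finset.sum_congr rfl fun s hs => Finset.sum_congr rfl fun t ht => ?_
    rw [FluctuationComparisonRegPrIntLS2BetaCoarseCurlLocal.covWalkSum_plaq'_congr_of_corner hj U₀ y hμν hagree' i (Finset.mem_range.1 hs) (Finset.mem_range.1 ht)]
  rw [Finset.sum_congr rfl hdil] at hC
  refine hC.trans ?_
  have m1 := curlAvgBound_mono (S := (0 : ℝ)) (Lr := (P.L : ℝ)) (ℓ := (((P.d + 2) * P.L : ℕ) : ℝ)) hδ hα0 hαp0 (Nat.cast_nonneg _) (Nat.cast_nonneg _) hnorm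
  have m5 : 4 * (404 * (((P.d + 2) * P.L : ℕ) : ℝ) * α * ‖X'‖) ≤ 4 * (404 * (((P.d + 2) * P.L : ℕ) : ℝ) * α * M) := by gcongr
  linarith

end Local

/-! ## §4 ★★★ The row in the lower-left convention (px16's (K5) shape), generic `N`, with the remainder letter -/

section Row

/-- ★★★ **THE ROW WITH A FREE REMAINDER LETTER, LOWER-LEFT CONVENTION**: §3 with its dilution term re-read plaquette by plaquette from the lower-LEFT corners
`x_a = blockSite y′ r_a + s_a e_μ + t_a e_ν` by `[μ⁺, ν⁺, μ̄, ν̄]` (✓M-1′ `summand_LR_le_LL`, price `2δ·L²·M`):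
`‖Y_{Ū(U₀)}(∂p′)[↑ψ_{U₀}(X)]‖ ≤ |I|⁻¹·Σ_a ‖Y_{U₀}(∂q_{x_a})[X̂]‖ + [L·L·2δ(3L+2)M + 48αLM + (2α_p + 24α)ℓM + 4·404ℓαM + 4R + 2δL²M]`.
[cite: Balaban1985Averaging, Prop. 1 (51) p.26, Prop. 3 (121)-(126) p.36, (58) p.27; Balaban1987RG1, (0.4), (0.8), (0.18) pp.253-255] -/
theorem row_LL_of_remainder (hj : j + 1 ≤ P.m + P.K) (U₀ : GaugeField P j (SU N)) {α : ℝ} (hα : ∀ (c : PBond P (j + 1)) (i : Idx P), dist1 (loopHol U₀ c i) ≤ α)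
    (hα24 : α ≤ 1 / 24) (hαδ : α < deltaSU (Fin N)) {δ : ℝ} (hδ : 0 ≤ δ) (hU : PlaqSmall δ U₀) (y : Site P (j + 1)) {μ ν : Fin P.d} (hμν : μ ≠ ν) {αp : ℝ}
    (hαp : dist1 (holAt (avgFun (expMeanLogSU (n := Fin N)) U₀) (walk y [((μ, true) : Letter P.d), (ν, true), (μ, false), (ν, false)])) ≤ αp)
    (X : PBond P j → (specialUnitaryLogChart (Fin N)).lie) {M : ℝ} (hM : 0 ≤ M)
    (hXM : ∀ b : PBond P j, (blockOf b.src = y ∨ blockOf b.src = y.shift μ ∨ blockOf b.src = y.shift ν ∨ blockOf b.src = (y.shift μ).shift ν) → ‖X b‖ ≤ M) {R : ℝ}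
    (hrem : ∀ c : PBond P (j + 1), (c = ⟨y, μ⟩ ∨ c = ⟨y.shift μ, ν⟩ ∨ c = ⟨y.shift ν, μ⟩ ∨ c = ⟨y, ν⟩) →
      ‖(((isChartRep_specialUnitaryGroup (n := Fin N)).logChart (avgFun (expMeanLogSU (n := Fin N)) (fun b => (isChartRep_specialUnitaryGroup (n := Fin N)).expChart (X b) * U₀ b) c * (avgFun (expMeanLogSU (n := Fin N)) U₀ c)⁻¹) : (specialUnitaryLogChart (Fin N)).lie) : Matrix (Fin N) (Fin N) ℂ) -
        ((fderiv ℝ (fun (A : PBond P j → (specialUnitaryLogChart (Fin N)).lie) (c : PBond P (j + 1)) => (isChartRep_specialUnitaryGroup (n := Fin N)).logChart (avgFun (expMeanLogSU (n := Fin N)) (fun b => (isChartRep_specialUnitaryGroup (n := Fin N)).expChart (A b) * U₀ b) c * (avgFun (expMeanLogSU (n := Fin N)) U₀ c)⁻¹)) 0 X c : (specialUnitaryLogChart (Fin N)).lie) : Matrix (Fin N) (Fin N) ℂ)‖ ≤ R) :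
    ‖covWalkSum (avgFun (expMeanLogSU (n := Fin N)) U₀)
        (fun c : PBond P (j + 1) => (((isChartRep_specialUnitaryGroup (n := Fin N)).logChart (avgFun (expMeanLogSU (n := Fin N)) (fun b => (isChartRep_specialUnitaryGroup (n := Fin N)).expChart (X b) * U₀ b) c * (avgFun (expMeanLogSU (n := Fin N)) U₀ c)⁻¹) : (specialUnitaryLogChart (Fin N)).lie) : Matrix (Fin N) (Fin N) ℂ))
        (walk y [((μ, true) : Letter P.d), (ν, true), (μ, false), (ν, false)])‖ ≤
      (Fintype.card (Idx P) : ℝ)⁻¹ * ∑ a ∈ (Finset.univ : Finset (Idx P)) ×ˢ (Finset.range P.L ×ˢ Finset.range P.L),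
          ‖covWalkSum U₀ (fun b => ((X b : (specialUnitaryLogChart (Fin N)).lie) : Matrix (Fin N) (Fin N) ℂ))
            (walk (shiftN (shiftN (Site.blockSite y a.1.1) μ a.2.1) ν a.2.2) [((μ, true) : Letter P.d), (ν, true), (μ, false), (ν, false)])‖ +
        ((P.L : ℝ) * ((P.L : ℝ) * (2 * δ * ((P.L : ℝ) + 2 * P.L + 2) * M)) + 48 * α * ((P.L : ℝ) * M) +
          (2 * αp * ((((P.d + 2) * P.L : ℕ) : ℝ) * M) + 24 * α * ((((P.d + 2) * P.L : ℕ) : ℝ) * M)) +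
          4 * (404 * (((P.d + 2) * P.L : ℕ) : ℝ) * α * M) + 4 * R +
          2 * δ * ((P.L : ℝ) ^ 2 * M)) := by
  have hE := norm_curl_chartRead_le_local_of_remainder hj U₀ hα hα24 hαδ hδ hU y hμν hαp X hM hXM hrem
  -- summand by summand (✓M-1′ `summand_LR_le_LL`)
  have hsum : ∑ i : Idx P, ∑ s ∈ Finset.range P.L, ∑ t ∈ Finset.range P.L,
        ‖covWalkSum U₀ (fun b => ((X b : (specialUnitaryLogChart (Fin N)).lie) : Matrix (Fin N) (Fin N) ℂ))
          (walk (walkEnd (walkEnd (emb y) (stairWord i.2.1 (off i.1))) (List.replicate (s + 1) (μ, true) ++ List.replicate t (ν, true)))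
          [((ν, true) : Letter P.d), (μ, false), (ν, false), (μ, true)])‖ ≤
      ∑ i : Idx P, ∑ s ∈ Finset.range P.L, ∑ t ∈ Finset.range P.L,
        (‖covWalkSum U₀ (fun b => ((X b : (specialUnitaryLogChart (Fin N)).lie) : Matrix (Fin N) (Fin N) ℂ))
          (walk (shiftN (shiftN (Site.blockSite y i.1) μ s) ν t) [((μ, true) : Letter P.d), (ν, true), (μ, false), (ν, false)])‖ + 2 * δ * M) := by
    refine Finset.sum_le_sum fun i _ => Finset.sum_le_sum fun s hs => Finset.sum_le_sum fun t ht => ?_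
    exact summand_LR_le_LL hj U₀ hδ hU y hμν X hXM i (Finset.mem_range.1 hs) (Finset.mem_range.1 ht)
  have hconst : ∑ i : Idx P, ∑ s ∈ Finset.range P.L, ∑ t ∈ Finset.range P.L,
        (‖covWalkSum U₀ (fun b => ((X b : (specialUnitaryLogChart (Fin N)).lie) : Matrix (Fin N) (Fin N) ℂ))
          (walk (shiftN (shiftN (Site.blockSite y i.1) μ s) ν t) [((μ, true) : Letter P.d), (ν, true), (μ, false), (ν, false)])‖ + 2 * δ * M) =
      ∑ a ∈ (Finset.univ : Finset (Idx P)) ×ˢ (Finset.range P.L ×ˢ Finset.range P.L),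
          ‖covWalkSum U₀ (fun b => ((X b : (specialUnitaryLogChart (Fin N)).lie) : Matrix (Fin N) (Fin N) ℂ))
            (walk (shiftN (shiftN (Site.blockSite y a.1.1) μ a.2.1) ν a.2.2) [((μ, true) : Letter P.d), (ν, true), (μ, false), (ν, false)])‖ +
        (Fintype.card (Idx P) : ℝ) * ((P.L : ℝ) ^ 2 * (2 * δ * M)) := by
    rw [← sum_Idx_range_range_eq_sum_product (fun i s t =>
      ‖covWalkSum U₀ (fun b => ((X b : (specialUnitaryLogChart (Fin N)).lie) : Matrix (Fin N) (Fin N) ℂ))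
        (walk (shiftN (shiftN (Site.blockSite y i.1) μ s) ν t) [((μ, true) : Letter P.d), (ν, true), (μ, false), (ν, false)])‖)]
    simp only [Finset.sum_add_distrib, Finset.sum_const, Finset.card_range, Finset.card_univ, nsmul_eq_mul]
    ring
  have hcard : (Fintype.card (Idx P) : ℝ)⁻¹ * ((Fintype.card (Idx P) : ℝ) * ((P.L : ℝ) ^ 2 * (2 * δ * M))) = 2 * δ * ((P.L : ℝ) ^ 2 * M) := by
    have hc : (Fintype.card (Idx P) : ℝ) ≠ 0 := Nat.cast_ne_zero.mpr Fintype.card_ne_zero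
    field_simp
  have hinv : 0 ≤ (Fintype.card (Idx P) : ℝ)⁻¹ := inv_nonneg.mpr (Nat.cast_nonneg _)
  have hmul := mul_le_mul_of_nonneg_left (hsum.trans_eq hconst) hinv
  rw [mul_add, hcard] at hmul
  linarith

end Row

/-! ## §5 ★★★ The tower edition and (K5)'s binders, with the remainder letter `R i y′` -/

section Tower

/-- ★★★ **THE ROWS WITH A FREE REMAINDER LETTER — TOWER EDITION, generic `N`**: for a tower `U (i+1) = Ū(U i)`, `X (i+1) = ψ_{U i}(X i)` (`i < r ≤ m + K`) with per-step guards indexed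
by the coarse level (`α_{i+1} ≤ 1∕24`, `α_{i+1} < δ_N` for the loops of `U i`; `PlaqSmall δ_{i+1} (U i)`; coarse plaquettes `α^p_{i+1}`), local sizes `M (i+1) y′ ≥ ‖X i b‖` on the
four corner blocks of `(y′; μ, ν)`, AND A REMAINDER LETTER `R (i+1) y′` bounding `‖↑(ψ_{U i}(X i)c) − ↑((Dψ_{U i}(0)(X i))c)‖` on the four bonds of `∂(y′; μ, ν)`, the relative-curl sizes
`ρ i x := ‖Y_{U i}(walk x [μ⁺,ν⁺,μ̄,ν̄])[X̂ i]‖` satisfy the (K5) row with source `L·L·2δ_i(3L+2)·M + 48α_i·L·M + (2α^p_i + 24α_i)·ℓ·M + 4·404·ℓ·α_i·M + 4·R + 2δ_i·L²·M` (at `(i, y′)`).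
[cite: Balaban1985Averaging, Prop. 1 (51) p.26, Prop. 3 (121)-(126) p.36, Prop. 4 (128)-(135) pp.37-38; Balaban1987RG1, (0.4), (0.8), (0.18) pp.253-255] -/
theorem rows_LL_tower_of_remainder {μ ν : Fin P.d} (hμν : μ ≠ ν) (r : ℕ) (hr : r ≤ P.m + P.K)
    (U : (i : ℕ) → GaugeField P i (SU N)) (X : (i : ℕ) → PBond P i → (specialUnitaryLogChart (Fin N)).lie)
    (hU : ∀ i, i < r → U (i + 1) = avgFun (expMeanLogSU (n := Fin N)) (U i))
    (hX : ∀ i, i < r → X (i + 1) = fun c : PBond P (i + 1) => (isChartRep_specialUnitaryGroup (n := Fin N)).logChart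
        (avgFun (expMeanLogSU (n := Fin N)) (fun b => (isChartRep_specialUnitaryGroup (n := Fin N)).expChart (X i b) * U i b) c *
          (avgFun (expMeanLogSU (n := Fin N)) (U i) c)⁻¹))
    (α δ αp : ℕ → ℝ)
    (hα : ∀ i, i < r → ∀ (c : PBond P (i + 1)) (ι : Idx P), dist1 (loopHol (U i) c ι) ≤ α (i + 1))
    (hα24 : ∀ i, i < r → α (i + 1) ≤ 1 / 24) (hαδ : ∀ i, i < r → α (i + 1) < deltaSU (Fin N))
    (hδ : ∀ i, i < r → 0 ≤ δ (i + 1)) (hUs : ∀ i, i < r → PlaqSmall (δ (i + 1)) (U i))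
    (hαp : ∀ i, i < r → ∀ y' : Site P (i + 1),
      dist1 (holAt (avgFun (expMeanLogSU (n := Fin N)) (U i)) (walk y' [((μ, true) : Letter P.d), (ν, true), (μ, false), (ν, false)])) ≤ αp (i + 1))
    (M : (i : ℕ) → Site P i → ℝ) (hM : ∀ i, i < r → ∀ y' : Site P (i + 1), 0 ≤ M (i + 1) y')
    (hXM : ∀ i, i < r → ∀ (y' : Site P (i + 1)) (b : PBond P i),
      (blockOf b.src = y' ∨ blockOf b.src = y'.shift μ ∨ blockOf b.src = y'.shift ν ∨ blockOf b.src = (y'.shift μ).shift ν) → ‖X i b‖ ≤ M (i + 1) y')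
    (R : (i : ℕ) → Site P i → ℝ)
    (hR : ∀ i, i < r → ∀ (y' : Site P (i + 1)) (c : PBond P (i + 1)), (c = ⟨y', μ⟩ ∨ c = ⟨y'.shift μ, ν⟩ ∨ c = ⟨y'.shift ν, μ⟩ ∨ c = ⟨y', ν⟩) →
      ‖(((isChartRep_specialUnitaryGroup (n := Fin N)).logChart (avgFun (expMeanLogSU (n := Fin N)) (fun b => (isChartRep_specialUnitaryGroup (n := Fin N)).expChart (X i b) * U i b) c * (avgFun (expMeanLogSU (n := Fin N)) (U i) c)⁻¹) : (specialUnitaryLogChart (Fin N)).lie) : Matrix (Fin N) (Fin N) ℂ) -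
        ((fderiv ℝ (fun (A : PBond P i → (specialUnitaryLogChart (Fin N)).lie) (c : PBond P (i + 1)) => (isChartRep_specialUnitaryGroup (n := Fin N)).logChart (avgFun (expMeanLogSU (n := Fin N)) (fun b => (isChartRep_specialUnitaryGroup (n := Fin N)).expChart (A b) * U i b) c * (avgFun (expMeanLogSU (n := Fin N)) (U i) c)⁻¹)) 0 (X i) c : (specialUnitaryLogChart (Fin N)).lie) : Matrix (Fin N) (Fin N) ℂ)‖ ≤ R (i + 1) y') :
    ∀ i, i < r → ∀ y' : Site P (i + 1),
      ‖covWalkSum (U (i + 1)) (fun c => ((X (i + 1) c : (specialUnitaryLogChart (Fin N)).lie) : Matrix (Fin N) (Fin N) ℂ))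
          (walk y' [((μ, true) : Letter P.d), (ν, true), (μ, false), (ν, false)])‖ ≤
        (Fintype.card (Idx P) : ℝ)⁻¹ * ∑ a ∈ (Finset.univ : Finset (Idx P)) ×ˢ (Finset.range P.L ×ˢ Finset.range P.L),
          ‖covWalkSum (U i) (fun b => ((X i b : (specialUnitaryLogChart (Fin N)).lie) : Matrix (Fin N) (Fin N) ℂ))
            (walk (shiftN (shiftN (Site.blockSite y' a.1.1) μ a.2.1) ν a.2.2) [((μ, true) : Letter P.d), (ν, true), (μ, false), (ν, false)])‖ +
          ((P.L : ℝ) * ((P.L : ℝ) * (2 * δ (i + 1) * ((P.L : ℝ) + 2 * P.L + 2) * M (i + 1) y')) + 48 * α (i + 1) * ((P.L : ℝ) * M (i + 1) y') +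
          (2 * αp (i + 1) * ((((P.d + 2) * P.L : ℕ) : ℝ) * M (i + 1) y') + 24 * α (i + 1) * ((((P.d + 2) * P.L : ℕ) : ℝ) * M (i + 1) y')) +
          4 * (404 * (((P.d + 2) * P.L : ℕ) : ℝ) * α (i + 1) * M (i + 1) y') + 4 * R (i + 1) y' +
            2 * δ (i + 1) * ((P.L : ℝ) ^ 2 * M (i + 1) y')) := by
  intro i hi y'
  rw [hU i hi, hX i hi]
  exact row_LL_of_remainder (by omega) (U i) (hα i hi) (hα24 i hi) (hαδ i hi) (hδ i hi) (hUs i hi) y' hμν (hαp i hi y') (X i) (hM i hi y') (hXM i hi y') (hR i hi y')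

/-- ★★ **THE SAME, PACKAGED AS (K5)'s BINDERS** (px16 g23's `exists_composedKernelFamily` ∕ ✓`weighted_readMax_sq_le_sources` row hypothesis VERBATIM): with `ρ` and `src` the two
displayed lambdas — `src i x = [linear part at M i x] + 4·R i x + 2δ_i·L²·M i x` — the rows hold. [cite: Balaban1985Averaging, Prop. 4 (128)-(135) pp.37-38] -/
theorem rows_LL_tower_of_remainder_K5 {μ ν : Fin P.d} (hμν : μ ≠ ν) (r : ℕ) (hr : r ≤ P.m + P.K)
    (U : (i : ℕ) → GaugeField P i (SU N)) (X : (i : ℕ) → PBond P i → (specialUnitaryLogChart (Fin N)).lie)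
    (hU : ∀ i, i < r → U (i + 1) = avgFun (expMeanLogSU (n := Fin N)) (U i))
    (hX : ∀ i, i < r → X (i + 1) = fun c : PBond P (i + 1) => (isChartRep_specialUnitaryGroup (n := Fin N)).logChart
        (avgFun (expMeanLogSU (n := Fin N)) (fun b => (isChartRep_specialUnitaryGroup (n := Fin N)).expChart (X i b) * U i b) c *
          (avgFun (expMeanLogSU (n := Fin N)) (U i) c)⁻¹))
    (α δ αp : ℕ → ℝ)
    (hα : ∀ i, i < r → ∀ (c : PBond P (i + 1)) (ι : Idx P), dist1 (loopHol (U i) c ι) ≤ α (i + 1))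
    (hα24 : ∀ i, i < r → α (i + 1) ≤ 1 / 24) (hαδ : ∀ i, i < r → α (i + 1) < deltaSU (Fin N))
    (hδ : ∀ i, i < r → 0 ≤ δ (i + 1)) (hUs : ∀ i, i < r → PlaqSmall (δ (i + 1)) (U i))
    (hαp : ∀ i, i < r → ∀ y' : Site P (i + 1),
      dist1 (holAt (avgFun (expMeanLogSU (n := Fin N)) (U i)) (walk y' [((μ, true) : Letter P.d), (ν, true), (μ, false), (ν, false)])) ≤ αp (i + 1))
    (M : (i : ℕ) → Site P i → ℝ) (hM : ∀ i, i < r → ∀ y' : Site P (i + 1), 0 ≤ M (i + 1) y')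
    (hXM : ∀ i, i < r → ∀ (y' : Site P (i + 1)) (b : PBond P i),
      (blockOf b.src = y' ∨ blockOf b.src = y'.shift μ ∨ blockOf b.src = y'.shift ν ∨ blockOf b.src = (y'.shift μ).shift ν) → ‖X i b‖ ≤ M (i + 1) y')
    (R : (i : ℕ) → Site P i → ℝ)
    (hR : ∀ i, i < r → ∀ (y' : Site P (i + 1)) (c : PBond P (i + 1)), (c = ⟨y', μ⟩ ∨ c = ⟨y'.shift μ, ν⟩ ∨ c = ⟨y'.shift ν, μ⟩ ∨ c = ⟨y', ν⟩) →
      ‖(((isChartRep_specialUnitaryGroup (n := Fin N)).logChart (avgFun (expMeanLogSU (n := Fin N)) (fun b => (isChartRep_specialUnitaryGroup (n := Fin N)).expChart (X i b) * U i b) c * (avgFun (expMeanLogSU (n := Fin N)) (U i) c)⁻¹) : (specialUnitaryLogChart (Fin N)).lie) : Matrix (Fin N) (Fin N) ℂ) -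
        ((fderiv ℝ (fun (A : PBond P i → (specialUnitaryLogChart (Fin N)).lie) (c : PBond P (i + 1)) => (isChartRep_specialUnitaryGroup (n := Fin N)).logChart (avgFun (expMeanLogSU (n := Fin N)) (fun b => (isChartRep_specialUnitaryGroup (n := Fin N)).expChart (A b) * U i b) c * (avgFun (expMeanLogSU (n := Fin N)) (U i) c)⁻¹)) 0 (X i) c : (specialUnitaryLogChart (Fin N)).lie) : Matrix (Fin N) (Fin N) ℂ)‖ ≤ R (i + 1) y')
    (ρ src : (i : ℕ) → Site P i → ℝ)
    (hρ : ρ = fun i x => ‖covWalkSum (U i) (fun b => ((X i b : (specialUnitaryLogChart (Fin N)).lie) : Matrix (Fin N) (Fin N) ℂ))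
      (walk x [((μ, true) : Letter P.d), (ν, true), (μ, false), (ν, false)])‖)
    (hsrc : src = fun i x => (P.L : ℝ) * ((P.L : ℝ) * (2 * δ i * ((P.L : ℝ) + 2 * P.L + 2) * M i x)) + 48 * α i * ((P.L : ℝ) * M i x) +
            (2 * αp i * ((((P.d + 2) * P.L : ℕ) : ℝ) * M i x) + 24 * α i * ((((P.d + 2) * P.L : ℕ) : ℝ) * M i x)) +
            4 * (404 * (((P.d + 2) * P.L : ℕ) : ℝ) * α i * M i x) + 4 * R i x +
            2 * δ i * ((P.L : ℝ) ^ 2 * M i x)) :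
    ∀ i, i < r → ∀ y' : Site P (i + 1),
      ρ (i + 1) y' ≤ (Fintype.card (Idx P) : ℝ)⁻¹ *
          ∑ a ∈ (Finset.univ : Finset (Idx P)) ×ˢ (Finset.range P.L ×ˢ Finset.range P.L), ρ i (shiftN (shiftN (Site.blockSite y' a.1.1) μ a.2.1) ν a.2.2) +
        src (i + 1) y' := by
  subst hρ hsrc
  exact rows_LL_tower_of_remainder hμν r hr U X hU hX α δ αp hα hα24 hαδ hδ hUs hαp M hM hXM R hR

end Tower

end Summit.QuantumFields.YangMills.Theorems.FluctuationComparisonRegPrIntLS2BetaCoarseCurlRowsRem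

end
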